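import Mathlib
import Literature.Combinatorics.Enumerative.EntropyBregmanLogSum

/-!
# Stub `stub_logIntegralBound` (crux stmt-MatrixMultiplication-8303, line bregman-entropy-window)

Crux `Summit.MatrixMultiplication.MatrixMultiplication.Theses.SnSubsetDichotomy.GlobalBranch`, line
`bregman-entropy-window` (lead's skeleton `Cruxes/GlobalBranch/Lines/bregman_entropy_window.lean`,
theorem `entropyBregman`), registered stub `stub_logIntegralBound`: the last analytic step of the
entropy form of Brégman's inequality ("minus one nat per vertex" for `η`-spread marginals).  The
expected logarithm of the marginal mass still available to a row revealed at a uniformly random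
position is `(1/n)·∑_{k<n} log (w + (1-w)·k/(n-1)) ≈ ∫₀¹ log (w + (1-w)u) du
= -1 + w·log(1/w)/(1-w) ≤ -1 + 4√w`; precisely, for `n ≥ 2` and `0 < w < 1`,

  `∑_{k<n} log (w + (1-w)·k/(n-1)) ≤ (n-1)·(4√w - 1)`.

The proof is the Literature theorem `Literature.Combinatorics.Enumerative.sum_log_affine_le`
(tangent-line inequality for `v log v - v` telescoped along the arithmetic progression, then
`w·log(1/w) ≤ 2√w·(1-w)`; the sharp and `2√w` forms are `sum_log_affine_le_sharp`,
`sum_log_affine_le_two_sqrt` there).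
-/

set_option linter.dupNamespace false

namespace Summit.MatrixMultiplication.MatrixMultiplication.Theorems.GlobalBranch

open scoped BigOperators

/-- **Stub `stub_logIntegralBound` — the entropy–Brégman log-sum estimate.**  For every
`n ≥ 2` and `0 < w < 1`: `∑_{k<n} log (w + (1-w)·k/(n-1)) ≤ (n-1)·(4√w - 1)` (a left Riemann
sum of the concave `u ↦ log (w + (1-w)u)` is at most its integral
`(n-1)·(-1 + w·log(1/w)/(1-w))`, and `w·log(1/w)/(1-w) ≤ 2√w ≤ 4√w`; via
`Literature.Combinatorics.Enumerative.sum_log_affine_le`). [folklore] -/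
theorem stub_logIntegralBound : ∀ (n : ℕ), 2 ≤ n → ∀ (w : ℝ), 0 < w → w < 1 →
    ∑ k ∈ Finset.range n, Real.log (w + (1 - w) * ((k : ℝ) / ((n : ℝ) - 1))) ≤
      ((n : ℝ) - 1) * (4 * Real.sqrt w - 1) :=
  fun n hn w hw hw1 => Literature.Combinatorics.Enumerative.sum_log_affine_le n hn w hw hw1

end Summit.MatrixMultiplication.MatrixMultiplication.Theorems.GlobalBranch
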